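import Literature.Probability.RandomPlanarGeometry.HexSAWBrickWallStripFugacityWidthOneTopContactFluctuations
import Literature.Probability.RandomPlanarGeometry.HexSAWBrickWallStripFugacityWidthOneFreeEnergyHessian
import Literature.Probability.RandomPlanarGeometry.HexSAWBrickWallStripFugacityWidthOneUniformAmplitudeRectangle
import HarnessLib

/-!
# Linear statistics of the two contact numbers of the width-one strip: the free energy along lines of log-fugacities,
# the variance of `v₁·bc + v₂·tc`, ★ the COVARIANCE `Cov_{N,y,z}(bc,tc)/N → ∂b/∂B < 0`, and the variance of the total contact number

Topic `Literature/Probability/RandomPlanarGeometry` (continues `…WidthOneContactVariance.lean` (★★★★ `tendsto_varContacts_div`: `Var(bc)/N → ∂b/∂A`),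
`…WidthOneTopContactFluctuations.lean` (`Var(tc)/N → ∂b(e^B,y)/∂B`, by reflection), `…WidthOneFreeEnergyHessian.lean` (first and second
directional derivatives of the free energy `log μ₁(e^A,e^B)` along lines; `H(v) > 0`), `…WidthOneContactSusceptibility.lean`
(`hasDerivAt_contactB_log`: `∂b/∂A = m₂₂/D`, `∂b/∂B = −m₁₂/D < 0 = ∂b'/∂A` — Maxwell) and `…WidthOneUniformAmplitudeRectangle.lean` (the uniform
two-term remainder on compact RECTANGLES of fugacity pairs)).  The one-wall theorems ran the quasi-linear engine `tendsto_deriv2_div_of_quasiLinear`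
along the coordinate tilts `(y e^t, z)` and `(y, z e^t)`; THIS FILE runs it along an ARBITRARY line `t ↦ (y e^{tv₁}, z e^{tv₂})`, whose tilt is the
exponential tilt of the linear statistic `L = v₁·bc + v₂·tc`.  Polarization then gives the one second-order quantity of the contact pair that was
missing — the covariance.

* §1 `contactHess v₁ v₂ y z = H_{y,z}(v) = (m₂₂v₁² − 2m₁₂v₁v₂ + m₁₁v₂²)/D` (the free-energy Hessian as a quadratic form), `contactHess_pos`,
  `contactHess_axes` (`H(1,0) = ∂b/∂A`, `H(0,1) = ∂b(e^B,y)/∂B`, `(H(1,1) − H(1,0) − H(0,1))/2 = ∂b/∂B`), ★★ `hasDerivAt_lineDeriv` (the directional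
  derivative `v₁b + v₂b'` has derivative `H(v)` at EVERY point of the line), `continuous_contactHess_line`, ★★ `contDiff_two_log_stripMuY₂_line`
  (`Λ_v(t) = log μ₁(e^{A+tv₁}, e^{B+tv₂})` is `C²` with `Λ_v' = v₁b + v₂b'`, `Λ_v'' = H(v)`).
* §2 the linear statistics under `P_{N,y,z}`: `meanLin`, `sqLin`, `varLin`, `covContacts`; `varLin_eq` (polarization
  `Var(v₁bc+v₂tc) = v₁²Var(bc) + 2v₁v₂Cov + v₂²Var(tc)`), `varLin_axes`; `stripZ₂_one_tilt₂_eq_sum` (`C_{1,N}(ye^{tv₁}, ze^{tv₂}) = Σ_q wgt·e^{tL}`),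
  ★★ `linContactFreeEnergy_facts` (`F_N' =` tilted mean, `F_N'' =` tilted variance `≥ 0`, `= Var(L)` at `0`, two-sided growth `e^{2(|v₁|+|v₂|)(N+1)t}` —
  CAR «FINITE LOG-LAPLACE CUMULANTS»).
* §3 `continuousOn_parityAmplitude₂` (joint continuity of `A_c(y,z)` on the quadrant), `parityAmplitude_bounds_rect`.
* §4 ★ `contDiff_two_parityG_line` (`cΛ_v + log A_c` along the line is `C²`).
* §5 ★★★ `tendsto_varLin_parity_div`: `Var_{2M+c}(v₁bc + v₂tc)/M → 2H(v)` (the engine, with the rectangle remainder on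
  `[ye^{−|v₁|}, ye^{|v₁|}] × [ze^{−|v₂|}, ze^{|v₂|}]`).
* §6 ★★★★ `tendsto_varLin_div` (`Var_{N,y,z}(v₁bc + v₂tc)/N → H_{y,z}(v)` for EVERY direction: the covariance MATRIX of `(bc,tc)` grows linearly
  with rate `M⁻¹`), ★★★★ `tendsto_covContacts_div` (`Cov_{N,y,z}(bc,tc)/N → ∂b/∂B|_{(log y, log z)}`), ★★★ `tendsto_covContacts_div_explicit`
  (`= −m₁₂/D < 0`: THE WALLS COMPETE at the level of fluctuations), ★★★ `tendsto_varTotalContacts_div` (`Var(bc+tc)/N → H(1,1) > 0`),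
  `tendsto_varLin_div_axes` (consistency with the one-wall theorems).

Numerics (`cov_check.py`, exact bivariate series kept polynomial in BOTH fugacities, stdlib): `(1,1)`: `Cov(bc,tc)/N = −0.1214, −0.1266, −0.1293,
−0.1307` (`N = 30, 60, 120, 240`) → `−m₁₂/D = −0.132009`, `N·(Cov/N − rate) = +0.324` constant (an `O(1/N)` law); `Var(bc+tc)/N → 0.017080`
(`0.0221, 0.0196, 0.0184, 0.0177`); asymptotic correlation coefficient `−0.9392`.  `(2,1)`: `Cov/N → −0.133621` (`−0.1333` at `N = 240`),
corr `→ −0.958`; `(½,3)`: `→ −0.052874` (`−0.0537`), corr `→ −0.982`.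

## Sources
A. Dembo, O. Zeitouni, *Large Deviations Techniques and Applications* (2010) §2.2–§2.3 (the limiting logarithmic mgf, its Hessian; lane statements);
E. J. Janse van Rensburg, *The Statistical Mechanics of Interacting Walks, Polygons, Animals and Vesicles* (1st ed., OUP 2000) §3.3 (fluctuations in
adsorption models); N. R. Beaton, M. Bousquet-Mélou, J. de Gier, H. Duminil-Copin, A. J. Guttmann, CMP 326 (2014), arXiv:1109.0358v5 §3.2 Proposition 6
(p. 10: the weights `y^{bc} z^{tc}`, `μ_T(y,z)`); N. Madras, G. Slade (1993) §1.1 eq. (1.1.4) p. 5; R. P. Stanley, EC1 §4.1 Theorem 4.1.1 (iii).  Nothing is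
quoted AS PRINTED; the statements and constants are this lineage's.
-/

noncomputable section

open Filter Topology Finset Set Literature.Analysis Literature.Probability.Moments
open Literature.Probability.LatticeModels Literature.Probability.Percolation

namespace Literature.Probability.RandomPlanarGeometry.SAW.HexBW

namespace WidthOneYZ

variable {y z : ℝ}

/-! ## §1 The free energy along a line in the log-fugacity plane is `C²`; its curvature `H(v)` -/

/-- **The Hessian quadratic form of the two-wall free energy** at the fugacity pair `(y,z)` in the direction `v = (v₁,v₂)`:
`H_{y,z}(v) = (m₂₂ v₁² − 2 m₁₂ v₁ v₂ + m₁₁ v₂²)/(m₁₁m₂₂ − m₁₂²)`, `b = b(y,z)`, `b' = b(z,y)`, `m_{ij}` the entries of `M = −Hess s` at the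
typical pair (tree: `hasDerivAt_dirDeriv_log_stripMuY₂`, `freeEnergyHessian_pos`) — the second directional derivative of
`(A,B) ↦ log μ₁(e^A,e^B)` and the limiting variance rate of the linear statistic `v₁·bc + v₂·tc`.
[cite: DemboZeitouni2010, §2.2–§2.3 (Hessian of the limiting logarithmic mgf; lane statement); JansevanRensburg2000, §3.3 (1st ed.)] -/
def contactHess (v₁ v₂ y z : ℝ) : ℝ :=
  (((4 / (1 - 2 * contactB y z - 2 * contactB z y) + 2 / (4 * contactB y z + 2 * contactB z y - 1)
        + 8 / (2 * contactB y z + 4 * contactB z y - 1) - 1 / contactB z y) * v₁ ^ 2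
      - 2 * (4 / (1 - 2 * contactB y z - 2 * contactB z y) + 4 / (4 * contactB y z + 2 * contactB z y - 1)
        + 4 / (2 * contactB y z + 4 * contactB z y - 1)) * v₁ * v₂
      + (4 / (1 - 2 * contactB y z - 2 * contactB z y) + 8 / (4 * contactB y z + 2 * contactB z y - 1)
        + 2 / (2 * contactB y z + 4 * contactB z y - 1) - 1 / contactB y z) * v₂ ^ 2)
    / ((4 / (1 - 2 * contactB y z - 2 * contactB z y) + 8 / (4 * contactB y z + 2 * contactB z y - 1)
          + 2 / (2 * contactB y z + 4 * contactB z y - 1) - 1 / contactB y z)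
        * (4 / (1 - 2 * contactB y z - 2 * contactB z y) + 2 / (4 * contactB y z + 2 * contactB z y - 1)
          + 8 / (2 * contactB y z + 4 * contactB z y - 1) - 1 / contactB z y)
      - (4 / (1 - 2 * contactB y z - 2 * contactB z y) + 4 / (4 * contactB y z + 2 * contactB z y - 1)
          + 4 / (2 * contactB y z + 4 * contactB z y - 1)) ^ 2))

/-- `H_{y,z}(v) > 0` for `v ≠ 0` and `y, z > 0` (tree: `freeEnergyHessian_pos`).
[cite: DemboZeitouni2010, §2.2 (Λ strictly convex; lane statement)] -/
theorem contactHess_pos (hy : 0 < y) (hz : 0 < z) {v₁ v₂ : ℝ} (hv : (v₁, v₂) ≠ (0, 0)) : 0 < contactHess v₁ v₂ y z := by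
  have h := freeEnergyHessian_pos (Real.log y) (Real.log z) hv
  simp only [Real.exp_log hy, Real.exp_log hz] at h
  unfold contactHess
  convert h using 1

/-- `H_{y,z}(1,0) = ∂b/∂A` (the bottom-wall variance rate of `tendsto_varContacts_div`), `H_{y,z}(0,1) = ∂b(e^B,y)/∂B` (the top-wall rate) and
the MIXED entry `(H(1,1) − H(1,0) − H(0,1))/2 = −m₁₂/D = ∂b/∂B` (tree: `hasDerivAt_contactB_log`).
[cite: DemboZeitouni2010, §2.2 (lane statement); JansevanRensburg2000, §3.3 (1st ed.)] -/
theorem contactHess_axes (hy : 0 < y) (hz : 0 < z) :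
    contactHess 1 0 y z = deriv (fun A => contactB (Real.exp A) z) (Real.log y) ∧
    contactHess 0 1 y z = deriv (fun B => contactB (Real.exp B) y) (Real.log z) ∧
    (contactHess 1 1 y z - contactHess 1 0 y z - contactHess 0 1 y z) / 2 = deriv (fun B => contactB y (Real.exp B)) (Real.log z) := by
  obtain ⟨hD, hm12, dA, dB, dBA, -, -⟩ := hasDerivAt_contactB_log (Real.log y) (Real.log z)
  obtain ⟨hD', -, dA', -, -, -, -⟩ := hasDerivAt_contactB_log (Real.log z) (Real.log y)
  simp only [Real.exp_log hy, Real.exp_log hz] at hD hm12 dA dB dBA hD' dA'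
  rw [dA.deriv, dA'.deriv, dB.deriv]
  unfold contactHess
  refine ⟨?_, ?_, ?_⟩
  · field_simp; ring
  · field_simp; ring
  · field_simp; ring

/-- ★★ **The directional derivative `t ↦ v₁ b + v₂ b'` along the line `(A + tv₁, B + tv₂)` has derivative `H(v)` at EVERY `t`**
(the tree's `hasDerivAt_dirDeriv_log_stripMuY₂` at the base point of parameter `t`).
[cite: DemboZeitouni2010, §2.2 (lane statement); JansevanRensburg2000, §3.3 (1st ed.)] -/
theorem hasDerivAt_lineDeriv (A B v₁ v₂ t : ℝ) :
    HasDerivAt (fun s : ℝ => v₁ * contactB (Real.exp (A + s * v₁)) (Real.exp (B + s * v₂))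
        + v₂ * contactB (Real.exp (B + s * v₂)) (Real.exp (A + s * v₁)))
      (contactHess v₁ v₂ (Real.exp (A + t * v₁)) (Real.exp (B + t * v₂))) t := by
  have h0 := hasDerivAt_dirDeriv_log_stripMuY₂ (A + t * v₁) (B + t * v₂) v₁ v₂
  -- shift the parameter: `s = t + τ`
  have e : (fun s : ℝ => v₁ * contactB (Real.exp (A + s * v₁)) (Real.exp (B + s * v₂))
        + v₂ * contactB (Real.exp (B + s * v₂)) (Real.exp (A + s * v₁))) =
      (fun τ : ℝ => v₁ * contactB (Real.exp (A + t * v₁ + τ * v₁)) (Real.exp (B + t * v₂ + τ * v₂))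
        + v₂ * contactB (Real.exp (B + t * v₂ + τ * v₂)) (Real.exp (A + t * v₁ + τ * v₁))) ∘ (fun s : ℝ => s - t) := by
    funext s
    simp only [Function.comp_apply]
    congr 2 <;> congr 1 <;> congr 1 <;> ring
  rw [e]
  have hsub : HasDerivAt (fun s : ℝ => s - t) 1 t := (hasDerivAt_id t).sub_const t
  have hc := HasDerivAt.comp t
    (h₂ := fun τ : ℝ => v₁ * contactB (Real.exp (A + t * v₁ + τ * v₁)) (Real.exp (B + t * v₂ + τ * v₂))
        + v₂ * contactB (Real.exp (B + t * v₂ + τ * v₂)) (Real.exp (A + t * v₁ + τ * v₁))) (by rw [sub_self]; exact h0) hsub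
  rw [mul_one] at hc
  unfold contactHess
  exact hc

/-- `t ↦ H_{(e^{A+tv₁}, e^{B+tv₂})}(v)` is continuous (the densities are differentiable along the line and stay inside the triangle, `D > 0`).
[cite: DemboZeitouni2010, §2.2 (lane plumbing)] -/
theorem continuous_contactHess_line (A B v₁ v₂ : ℝ) :
    Continuous fun t : ℝ => contactHess v₁ v₂ (Real.exp (A + t * v₁)) (Real.exp (B + t * v₂)) := by
  set bA : ℝ → ℝ := fun t => contactB (Real.exp (A + t * v₁)) (Real.exp (B + t * v₂)) with hbA
  set bB : ℝ → ℝ := fun t => contactB (Real.exp (B + t * v₂)) (Real.exp (A + t * v₁)) with hbB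
  -- continuity of the two densities along the line (joint continuity of `b` on the open quadrant)
  have hcA : Continuous bA := by
    refine continuous_iff_continuousAt.2 fun t => ?_
    have h := continuousAt_contactB₂ (Real.exp_pos (A + t * v₁)) (Real.exp_pos (B + t * v₂))
    have hg : ContinuousAt (fun t : ℝ => (Real.exp (A + t * v₁), Real.exp (B + t * v₂))) t := by fun_prop
    exact ContinuousAt.comp (f := fun t : ℝ => (Real.exp (A + t * v₁), Real.exp (B + t * v₂)))
      (g := fun p : ℝ × ℝ => contactB p.1 p.2) h hg
  have hcB : Continuous bB := by
    refine continuous_iff_continuousAt.2 fun t => ?_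
    have h := continuousAt_contactB₂ (Real.exp_pos (B + t * v₂)) (Real.exp_pos (A + t * v₁))
    have hg : ContinuousAt (fun t : ℝ => (Real.exp (B + t * v₂), Real.exp (A + t * v₁))) t := by fun_prop
    exact ContinuousAt.comp (f := fun t : ℝ => (Real.exp (B + t * v₂), Real.exp (A + t * v₁)))
      (g := fun p : ℝ × ℝ => contactB p.1 p.2) h hg
  have hden : ∀ t, 1 - 2 * bA t - 2 * bB t ≠ 0 ∧ 4 * bA t + 2 * bB t - 1 ≠ 0 ∧ 2 * bA t + 4 * bB t - 1 ≠ 0 ∧ bA t ≠ 0 ∧ bB t ≠ 0 ∧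
      (4 / (1 - 2 * bA t - 2 * bB t) + 8 / (4 * bA t + 2 * bB t - 1) + 2 / (2 * bA t + 4 * bB t - 1) - 1 / bA t)
        * (4 / (1 - 2 * bA t - 2 * bB t) + 2 / (4 * bA t + 2 * bB t - 1) + 8 / (2 * bA t + 4 * bB t - 1) - 1 / bB t)
        - (4 / (1 - 2 * bA t - 2 * bB t) + 4 / (4 * bA t + 2 * bB t - 1) + 4 / (2 * bA t + 4 * bB t - 1)) ^ 2 ≠ 0 := by
    intro t
    have hY := Real.exp_pos (A + t * v₁)
    have hZ := Real.exp_pos (B + t * v₂)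
    obtain ⟨t1, t2, t3⟩ := contactB_mem_triangle hY hZ
    have hb0 := (contactB_facts hY hZ).2.2.2.2.1
    have hb0' := (contactB_facts hZ hY).2.2.2.2.1
    have hD := (hasDerivAt_contactB_log (A + t * v₁) (B + t * v₂)).1
    refine ⟨by simp only [hbA, hbB]; linarith, by simp only [hbA, hbB]; linarith, by simp only [hbA, hbB]; linarith,
      hb0.ne', hb0'.ne', hD.ne'⟩
  have d1 : ∀ t, 1 - 2 * bA t - 2 * bB t ≠ 0 := fun t => (hden t).1
  have d2 : ∀ t, 4 * bA t + 2 * bB t - 1 ≠ 0 := fun t => (hden t).2.1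
  have d3 : ∀ t, 2 * bA t + 4 * bB t - 1 ≠ 0 := fun t => (hden t).2.2.1
  have d4 : ∀ t, bA t ≠ 0 := fun t => (hden t).2.2.2.1
  have d5 : ∀ t, bB t ≠ 0 := fun t => (hden t).2.2.2.2.1
  have d6 := fun t => (hden t).2.2.2.2.2
  show Continuous fun t : ℝ =>
    (((4 / (1 - 2 * bA t - 2 * bB t) + 2 / (4 * bA t + 2 * bB t - 1) + 8 / (2 * bA t + 4 * bB t - 1) - 1 / bB t) * v₁ ^ 2
      - 2 * (4 / (1 - 2 * bA t - 2 * bB t) + 4 / (4 * bA t + 2 * bB t - 1) + 4 / (2 * bA t + 4 * bB t - 1)) * v₁ * v₂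
      + (4 / (1 - 2 * bA t - 2 * bB t) + 8 / (4 * bA t + 2 * bB t - 1) + 2 / (2 * bA t + 4 * bB t - 1) - 1 / bA t) * v₂ ^ 2)
    / ((4 / (1 - 2 * bA t - 2 * bB t) + 8 / (4 * bA t + 2 * bB t - 1) + 2 / (2 * bA t + 4 * bB t - 1) - 1 / bA t)
        * (4 / (1 - 2 * bA t - 2 * bB t) + 2 / (4 * bA t + 2 * bB t - 1) + 8 / (2 * bA t + 4 * bB t - 1) - 1 / bB t)
      - (4 / (1 - 2 * bA t - 2 * bB t) + 4 / (4 * bA t + 2 * bB t - 1) + 4 / (2 * bA t + 4 * bB t - 1)) ^ 2))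
  fun_prop (disch := assumption)

/-- `C²` from derivative data (plumbing copy of the tree's private lemma). [cite: DemboZeitouni2010, §2.3 (lane plumbing)] -/
private theorem contDiff_two_of_hasDerivAt_two_lin {f f₁ f₂ : ℝ → ℝ} (h1 : ∀ x, HasDerivAt f (f₁ x) x) (h2 : ∀ x, HasDerivAt f₁ (f₂ x) x)
    (h3 : Continuous f₂) : ContDiff ℝ 2 f := by
  have hd1 : deriv f = f₁ := funext fun x => (h1 x).deriv
  have hd2 : deriv f₁ = f₂ := funext fun x => (h2 x).deriv
  rw [show (2 : WithTop ℕ∞) = (1 : WithTop ℕ∞) + 1 from rfl, contDiff_succ_iff_deriv]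
  refine ⟨fun x => (h1 x).differentiableAt, by simp, ?_⟩
  rw [hd1, show (1 : WithTop ℕ∞) = (0 : WithTop ℕ∞) + 1 from rfl, contDiff_succ_iff_deriv]
  refine ⟨fun x => (h2 x).differentiableAt, by simp, ?_⟩
  rw [hd2, contDiff_zero]
  exact h3

/-- ★★ **THE FREE ENERGY IS `C²` ALONG EVERY LINE OF LOG-FUGACITIES**: `t ↦ Λ_v(t) = log μ₁(e^{A+tv₁}, e^{B+tv₂})` is `ContDiff ℝ 2`, with
`Λ_v' = v₁ b + v₂ b'` along the line and `Λ_v'' = H(v)` there.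
[cite: DemboZeitouni2010, §2.3 (smoothness of the limiting logarithmic mgf; lane statement); BeatonBousquetMelouDeGierDuminilCopinGuttmann2014, §3.2 Proposition 6 (arXiv v5 p. 10)] -/
theorem contDiff_two_log_stripMuY₂_line (A B v₁ v₂ : ℝ) :
    ContDiff ℝ 2 (fun t : ℝ => Real.log (stripMuY₂ 1 (Real.exp (A + t * v₁)) (Real.exp (B + t * v₂)))) ∧
    (∀ t, HasDerivAt (fun t : ℝ => Real.log (stripMuY₂ 1 (Real.exp (A + t * v₁)) (Real.exp (B + t * v₂))))
      (v₁ * contactB (Real.exp (A + t * v₁)) (Real.exp (B + t * v₂)) + v₂ * contactB (Real.exp (B + t * v₂)) (Real.exp (A + t * v₁))) t) ∧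
    (∀ t, HasDerivAt (fun s : ℝ => v₁ * contactB (Real.exp (A + s * v₁)) (Real.exp (B + s * v₂))
        + v₂ * contactB (Real.exp (B + s * v₂)) (Real.exp (A + s * v₁)))
      (contactHess v₁ v₂ (Real.exp (A + t * v₁)) (Real.exp (B + t * v₂))) t) ∧
    Continuous (fun t : ℝ => contactHess v₁ v₂ (Real.exp (A + t * v₁)) (Real.exp (B + t * v₂))) :=
  ⟨contDiff_two_of_hasDerivAt_two_lin (hasDerivAt_log_stripMuY₂_line A B v₁ v₂) (hasDerivAt_lineDeriv A B v₁ v₂)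
    (continuous_contactHess_line A B v₁ v₂), hasDerivAt_log_stripMuY₂_line A B v₁ v₂, hasDerivAt_lineDeriv A B v₁ v₂,
    continuous_contactHess_line A B v₁ v₂⟩


/-! ## §2 Linear statistics of the two contact numbers under `P_{N,y,z}` -/

/-- **Mean of the linear statistic `v₁·bc + v₂·tc` under `P_{N,y,z}`.** [cite: BeatonBousquetMelouDeGierDuminilCopinGuttmann2014, §3.2 (arXiv v5 p. 10: the weights y^{bc} z^{tc})] -/
def meanLin (v₁ v₂ y z : ℝ) (N : ℕ) : ℝ :=
  (∑ q ∈ stripPairs 1 N, wgt y z N q * (v₁ * (bottomVisits₀ q.1 q.2 N : ℝ) + v₂ * (topVisits₀ 1 q.1 q.2 N : ℝ))) / stripZ₂ 1 N y z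

/-- **Second moment of `v₁·bc + v₂·tc` under `P_{N,y,z}`.** [cite: BeatonBousquetMelouDeGierDuminilCopinGuttmann2014, §3.2 (arXiv v5 p. 10)] -/
def sqLin (v₁ v₂ y z : ℝ) (N : ℕ) : ℝ :=
  (∑ q ∈ stripPairs 1 N, wgt y z N q * (v₁ * (bottomVisits₀ q.1 q.2 N : ℝ) + v₂ * (topVisits₀ 1 q.1 q.2 N : ℝ)) ^ 2) / stripZ₂ 1 N y z

/-- ★ **Variance of the linear statistic `v₁·bc + v₂·tc` under `P_{N,y,z}`.**
[cite: DemboZeitouni2010, §2.3 (lane statement); BeatonBousquetMelouDeGierDuminilCopinGuttmann2014, §3.2 (arXiv v5 p. 10)] -/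
def varLin (v₁ v₂ y z : ℝ) (N : ℕ) : ℝ := sqLin v₁ v₂ y z N - meanLin v₁ v₂ y z N ^ 2

/-- ★ **The covariance of the two contact numbers under `P_{N,y,z}`**: `Cov_{N,y,z}(bc, tc) = ⟨bc·tc⟩ − ⟨bc⟩⟨tc⟩`.
[cite: DemboZeitouni2010, §2.3 (lane statement); JansevanRensburg2000, §3.3 (1st ed.: fluctuations in adsorption models)] -/
def covContacts (y z : ℝ) (N : ℕ) : ℝ :=
  (∑ q ∈ stripPairs 1 N, wgt y z N q * ((bottomVisits₀ q.1 q.2 N : ℝ) * (topVisits₀ 1 q.1 q.2 N : ℝ))) / stripZ₂ 1 N y z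
    - meanContacts y z N * meanTopContacts y z N

/-- **Polarization**: `Var(v₁bc + v₂tc) = v₁²Var(bc) + 2v₁v₂Cov(bc,tc) + v₂²Var(tc)` (finite sums).
[cite: DemboZeitouni2010, §2.3 (lane plumbing)] -/
theorem varLin_eq (v₁ v₂ y z : ℝ) (N : ℕ) :
    varLin v₁ v₂ y z N = v₁ ^ 2 * varContacts y z N + 2 * v₁ * v₂ * covContacts y z N + v₂ ^ 2 * varTopContacts y z N := by
  unfold varLin sqLin meanLin covContacts varContacts sqContacts meanContacts varTopContacts sqTopContacts meanTopContacts
  set Z := stripZ₂ 1 N y z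
  have e1 : (∑ q ∈ stripPairs 1 N, wgt y z N q * (v₁ * (bottomVisits₀ q.1 q.2 N : ℝ) + v₂ * (topVisits₀ 1 q.1 q.2 N : ℝ)))
      = v₁ * ∑ q ∈ stripPairs 1 N, wgt y z N q * (bottomVisits₀ q.1 q.2 N : ℝ)
        + v₂ * ∑ q ∈ stripPairs 1 N, wgt y z N q * (topVisits₀ 1 q.1 q.2 N : ℝ) := by
    rw [Finset.mul_sum, Finset.mul_sum, ← Finset.sum_add_distrib]
    exact Finset.sum_congr rfl fun q _ => by ring
  have e2 : (∑ q ∈ stripPairs 1 N, wgt y z N q * (v₁ * (bottomVisits₀ q.1 q.2 N : ℝ) + v₂ * (topVisits₀ 1 q.1 q.2 N : ℝ)) ^ 2)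
      = v₁ ^ 2 * ∑ q ∈ stripPairs 1 N, wgt y z N q * (bottomVisits₀ q.1 q.2 N : ℝ) ^ 2
        + 2 * v₁ * v₂ * ∑ q ∈ stripPairs 1 N, wgt y z N q * ((bottomVisits₀ q.1 q.2 N : ℝ) * (topVisits₀ 1 q.1 q.2 N : ℝ))
        + v₂ ^ 2 * ∑ q ∈ stripPairs 1 N, wgt y z N q * (topVisits₀ 1 q.1 q.2 N : ℝ) ^ 2 := by
    rw [Finset.mul_sum, Finset.mul_sum, Finset.mul_sum, ← Finset.sum_add_distrib, ← Finset.sum_add_distrib]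
    exact Finset.sum_congr rfl fun q _ => by ring
  rw [e1, e2]
  ring

/-- `Var(1·bc + 0·tc) = Var(bc)` and `Var(0·bc + 1·tc) = Var(tc)`. [cite: DemboZeitouni2010, §2.3 (lane plumbing)] -/
theorem varLin_axes (y z : ℝ) (N : ℕ) : varLin 1 0 y z N = varContacts y z N ∧ varLin 0 1 y z N = varTopContacts y z N := by
  constructor <;> rw [varLin_eq] <;> ring

/-- **The two-parameter tilt is an exponential tilt of the linear statistic**:
`C_{1,N}(y e^{tv₁}, z e^{tv₂}) = Σ_q wgt_q(y,z) · e^{t(v₁ bc(q) + v₂ tc(q))}`.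
[cite: BeatonBousquetMelouDeGierDuminilCopinGuttmann2014, §3.2 (arXiv v5 p. 10); DemboZeitouni2010, §2.2 (lane statement)] -/
theorem stripZ₂_one_tilt₂_eq_sum (y z v₁ v₂ t : ℝ) (N : ℕ) :
    stripZ₂ 1 N (y * Real.exp (t * v₁)) (z * Real.exp (t * v₂))
      = ∑ q ∈ stripPairs 1 N, wgt y z N q
          * Real.exp (t * (v₁ * (bottomVisits₀ q.1 q.2 N : ℝ) + v₂ * (topVisits₀ 1 q.1 q.2 N : ℝ))) := by
  rw [stripZ₂_one_eq_sum_wgt]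
  refine Finset.sum_congr rfl fun q _ => ?_
  unfold wgt
  rw [mul_pow, mul_pow, ← Real.exp_nat_mul, ← Real.exp_nat_mul]
  rw [show t * (v₁ * (bottomVisits₀ q.1 q.2 N : ℝ) + v₂ * (topVisits₀ 1 q.1 q.2 N : ℝ))
      = (bottomVisits₀ q.1 q.2 N : ℝ) * (t * v₁) + (topVisits₀ 1 q.1 q.2 N : ℝ) * (t * v₂) by ring, Real.exp_add]
  ring

/-- `stripPairs 1 N` is nonempty (plumbing). [cite: BeatonBousquetMelouDeGierDuminilCopinGuttmann2014, §3.2 (lane plumbing)] -/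
private theorem stripPairs_one_nonempty_lin (N : ℕ) : (stripPairs 1 N).Nonempty := by
  have h := stripZ₂_pos 1 N one_pos one_pos
  rw [stripZ₂_one_eq_sum_wgt] at h
  exact Finset.nonempty_of_sum_ne_zero h.ne'

/-- The tilted sums at `t = 0` (bookkeeping). [cite: DemboZeitouni2010, §2.2 (lane plumbing)] -/
private theorem tilt₂_sums_at_zero (v₁ v₂ y z : ℝ) (N : ℕ) :
    (∑ q ∈ stripPairs 1 N, wgt y z N q
        * Real.exp (0 * (v₁ * (bottomVisits₀ q.1 q.2 N : ℝ) + v₂ * (topVisits₀ 1 q.1 q.2 N : ℝ)))) = stripZ₂ 1 N y z ∧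
    (∑ q ∈ stripPairs 1 N, wgt y z N q * (v₁ * (bottomVisits₀ q.1 q.2 N : ℝ) + v₂ * (topVisits₀ 1 q.1 q.2 N : ℝ))
        * Real.exp (0 * (v₁ * (bottomVisits₀ q.1 q.2 N : ℝ) + v₂ * (topVisits₀ 1 q.1 q.2 N : ℝ))))
      = ∑ q ∈ stripPairs 1 N, wgt y z N q * (v₁ * (bottomVisits₀ q.1 q.2 N : ℝ) + v₂ * (topVisits₀ 1 q.1 q.2 N : ℝ)) ∧
    (∑ q ∈ stripPairs 1 N, wgt y z N q * (v₁ * (bottomVisits₀ q.1 q.2 N : ℝ) + v₂ * (topVisits₀ 1 q.1 q.2 N : ℝ)) ^ 2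
        * Real.exp (0 * (v₁ * (bottomVisits₀ q.1 q.2 N : ℝ) + v₂ * (topVisits₀ 1 q.1 q.2 N : ℝ))))
      = ∑ q ∈ stripPairs 1 N, wgt y z N q * (v₁ * (bottomVisits₀ q.1 q.2 N : ℝ) + v₂ * (topVisits₀ 1 q.1 q.2 N : ℝ)) ^ 2 := by
  refine ⟨?_, ?_, ?_⟩ <;> simp only [zero_mul, Real.exp_zero, mul_one, stripZ₂_one_eq_sum_wgt]

/-- ★★ **The free energy `F_N(t) = log C_{1,N}(y e^{tv₁}, z e^{tv₂})` along the two-parameter tilt**: `F_N' =` tilted mean of `L = v₁bc + v₂tc`,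
`F_N'' =` tilted variance `v_N(t) ≥ 0`, `v_N(0) = Var_{N,y,z}(L)`, and — since `L` takes values in an interval of length `(|v₁|+|v₂|)(N+1)` — no
oscillation on scales `≪ 1/N`: `v_N(t) ≤ e^{2(|v₁|+|v₂|)(N+1)t} v_N(0)`, `v_N(0) ≤ e^{2(|v₁|+|v₂|)(N+1)t} v_N(t)` for `t ≥ 0` (CAR «FINITE LOG-LAPLACE
CUMULANTS»).
[cite: DemboZeitouni2010, §2.2–§2.3 (lane statement); BeatonBousquetMelouDeGierDuminilCopinGuttmann2014, §3.2 (arXiv v5 p. 10)] -/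
theorem linContactFreeEnergy_facts (hy : 0 < y) (hz : 0 < z) (v₁ v₂ : ℝ) (N : ℕ) :
    let L : Site 2 × (ℕ → Site 2) → ℝ := fun q => v₁ * (bottomVisits₀ q.1 q.2 N : ℝ) + v₂ * (topVisits₀ 1 q.1 q.2 N : ℝ)
    let Z : ℝ → ℝ := fun t => ∑ q ∈ stripPairs 1 N, wgt y z N q * Real.exp (t * L q)
    let M₁ : ℝ → ℝ := fun t => ∑ q ∈ stripPairs 1 N, wgt y z N q * L q * Real.exp (t * L q)
    let M₂ : ℝ → ℝ := fun t => ∑ q ∈ stripPairs 1 N, wgt y z N q * L q ^ 2 * Real.exp (t * L q)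
    let v : ℝ → ℝ := fun t => M₂ t / Z t - (M₁ t / Z t) ^ 2
    (∀ t, HasDerivAt (fun t => Real.log (stripZ₂ 1 N (y * Real.exp (t * v₁)) (z * Real.exp (t * v₂)))) (M₁ t / Z t) t) ∧
    (∀ t, HasDerivAt (fun t => M₁ t / Z t) (v t) t) ∧
    (∀ t, 0 ≤ v t) ∧ v 0 = varLin v₁ v₂ y z N ∧ M₁ 0 / Z 0 = meanLin v₁ v₂ y z N ∧
    (∀ t, 0 ≤ t → v t ≤ Real.exp (2 * ((|v₁| + |v₂|) * ((N : ℝ) + 1)) * t) * v 0 ∧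
      v 0 ≤ Real.exp (2 * ((|v₁| + |v₂|) * ((N : ℝ) + 1)) * t) * v t) := by
  intro L Z M₁ M₂ v
  have hs : (stripPairs 1 N).Nonempty := stripPairs_one_nonempty_lin N
  have hw : ∀ q ∈ stripPairs 1 N, 0 < wgt y z N q := fun q _ => wgt_pos hy hz N q
  -- the values of `L` lie in an interval of length `2(|v₁| + |v₂|)(N+1)`
  have hx : ∀ q ∈ stripPairs 1 N, -((|v₁| + |v₂|) * ((N : ℝ) + 1)) ≤ L q ∧
      L q ≤ -((|v₁| + |v₂|) * ((N : ℝ) + 1)) + 2 * ((|v₁| + |v₂|) * ((N : ℝ) + 1)) := by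
    intro q _
    have hb : ((bottomVisits₀ q.1 q.2 N : ℕ) : ℝ) ≤ (N : ℝ) + 1 := by exact_mod_cast bottomVisits₀_le q.1 q.2 N
    have ht : ((topVisits₀ 1 q.1 q.2 N : ℕ) : ℝ) ≤ (N : ℝ) + 1 := by exact_mod_cast topVisits₀_le 1 q.1 q.2 N
    have hb0 : (0 : ℝ) ≤ (bottomVisits₀ q.1 q.2 N : ℝ) := Nat.cast_nonneg _
    have ht0 : (0 : ℝ) ≤ (topVisits₀ 1 q.1 q.2 N : ℝ) := Nat.cast_nonneg _
    have h1 : |v₁ * (bottomVisits₀ q.1 q.2 N : ℝ)| ≤ |v₁| * ((N : ℝ) + 1) := by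
      rw [abs_mul, abs_of_nonneg hb0]; exact mul_le_mul_of_nonneg_left hb (abs_nonneg _)
    have h2 : |v₂ * (topVisits₀ 1 q.1 q.2 N : ℝ)| ≤ |v₂| * ((N : ℝ) + 1) := by
      rw [abs_mul, abs_of_nonneg ht0]; exact mul_le_mul_of_nonneg_left ht (abs_nonneg _)
    have a1 := abs_le.1 h1
    have a2 := abs_le.1 h2
    constructor
    · show _ ≤ v₁ * (bottomVisits₀ q.1 q.2 N : ℝ) + v₂ * (topVisits₀ 1 q.1 q.2 N : ℝ); linarith [a1.1, a2.1]
    · show v₁ * (bottomVisits₀ q.1 q.2 N : ℝ) + v₂ * (topVisits₀ 1 q.1 q.2 N : ℝ) ≤ _; linarith [a1.2, a2.2]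
  refine ⟨?_, ?_, ?_, ?_, ?_, ?_⟩
  · intro t
    have h := hasDerivAt_log_finLaplace (x := L) (w := wgt y z N) hs hw t
    have e : (fun t => Real.log (stripZ₂ 1 N (y * Real.exp (t * v₁)) (z * Real.exp (t * v₂))))
        = fun t => Real.log (∑ q ∈ stripPairs 1 N, wgt y z N q * Real.exp (t * L q)) := by
      funext u; rw [stripZ₂_one_tilt₂_eq_sum]
    rw [e]; exact h
  · intro t
    exact hasDerivAt_finLaplace_mean (x := L) (w := wgt y z N) hs hw t
  · intro t
    exact finLaplace_var_nonneg (x := L) (w := wgt y z N) hs hw t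
  · obtain ⟨e0, e1, e2⟩ := tilt₂_sums_at_zero v₁ v₂ y z N
    show M₂ 0 / Z 0 - (M₁ 0 / Z 0) ^ 2 = varLin v₁ v₂ y z N
    simp only [Z, M₁, M₂, L, e0, e1, e2, varLin, sqLin, meanLin]
  · obtain ⟨e0, e1, -⟩ := tilt₂_sums_at_zero v₁ v₂ y z N
    show M₁ 0 / Z 0 = meanLin v₁ v₂ y z N
    simp only [Z, M₁, L, e0, e1, meanLin]
  · intro t ht
    exact finLaplace_var_le_exp_mul (x := L) (w := wgt y z N) hs hw hx ht

/-! ## §3 The parity amplitudes on compact rectangles -/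

/-- ★ `(y,z) ↦ A_c(y,z)` is jointly continuous on the open quadrant (rational in `y, z, μ₁(y,z)` with a positive denominator).
[cite: BeatonBousquetMelouDeGierDuminilCopinGuttmann2014, Proposition 6 (arXiv v5 p. 10: μ continuous); MadrasSlade1993, §1.1 (lane statement)] -/
theorem continuousOn_parityAmplitude₂ (c : ℕ) :
    ContinuousOn (fun p : ℝ × ℝ => parityAmplitude c p.1 p.2) (Set.Ioi (0 : ℝ) ×ˢ Set.Ioi (0 : ℝ)) := by
  set S : Set (ℝ × ℝ) := Set.Ioi (0 : ℝ) ×ˢ Set.Ioi (0 : ℝ)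
  have hS1 : ∀ p ∈ S, (0 : ℝ) < p.1 := fun p hp => hp.1
  have hS2 : ∀ p ∈ S, (0 : ℝ) < p.2 := fun p hp => hp.2
  have hμc : ContinuousOn (fun p : ℝ × ℝ => stripMuY₂ 1 p.1 p.2) S := continuousOn_stripMuY₂ 1
  obtain ⟨-, -, cU0, cU1, cU2, cU3, cU4, cU5, -, -, -, -, -, -, -, -⟩ := continuous_pfCoeffs₂
  have hd1 : ∀ p ∈ S, ((p.1 - p.2) ^ 2 + 2 * p.1 + 2 * p.2 + 1) ^ 2 *
      ((p.1 + p.2) * (stripMuY₂ 1 p.1 p.2 ^ 2) ^ 2 - 2 * (p.1 * p.2) * stripMuY₂ 1 p.1 p.2 ^ 2 + 3 * (p.1 * p.2)) ≠ 0 := by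
    intro p hp
    have h1 := hS1 p hp; have h2 := hS2 p hp
    exact mul_ne_zero (by positivity) (amplitudeDen_pos h1 h2).ne'
  have hd2 : ∀ p ∈ S, ((p.1 - p.2) ^ 2 + 2 * p.1 + 2 * p.2 + 1) ^ 2 * stripMuY₂ 1 p.1 p.2 *
      ((p.1 + p.2) * (stripMuY₂ 1 p.1 p.2 ^ 2) ^ 2 - 2 * (p.1 * p.2) * stripMuY₂ 1 p.1 p.2 ^ 2 + 3 * (p.1 * p.2)) ≠ 0 := by
    intro p hp
    have h1 := hS1 p hp; have h2 := hS2 p hp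
    exact mul_ne_zero (mul_ne_zero (by positivity) (stripMuY₂_pos 1 h1 h2).ne') (amplitudeDen_pos h1 h2).ne'
  rcases Nat.eq_zero_or_pos c with h0 | h0
  · subst h0
    simp only [parityAmplitude, if_true]
    fun_prop (disch := assumption)
  · have hc : c ≠ 0 := by omega
    simp only [parityAmplitude, hc, if_false]
    fun_prop (disch := assumption)

/-- Uniform positive bounds for `A_c` on a compact rectangle of fugacity pairs. [cite: MadrasSlade1993, §1.1 eq. (1.1.4) p. 5 (lane statement)] -/
theorem parityAmplitude_bounds_rect {y₁ y₂ z₁ z₂ : ℝ} (hy₁ : 0 < y₁) (h12 : y₁ ≤ y₂) (hz₁ : 0 < z₁) (hz12 : z₁ ≤ z₂) {c : ℕ} (hc : c < 2) :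
    ∃ a₁ a₂ : ℝ, 0 < a₁ ∧ ∀ y ∈ Set.Icc y₁ y₂, ∀ z ∈ Set.Icc z₁ z₂, a₁ ≤ parityAmplitude c y z ∧ parityAmplitude c y z ≤ a₂ := by
  set S : Set (ℝ × ℝ) := Set.Icc y₁ y₂ ×ˢ Set.Icc z₁ z₂
  have hne : S.Nonempty := ⟨(y₁, z₁), ⟨le_rfl, h12⟩, ⟨le_rfl, hz12⟩⟩
  have hsub : S ⊆ Set.Ioi (0 : ℝ) ×ˢ Set.Ioi (0 : ℝ) := fun p hp => ⟨lt_of_lt_of_le hy₁ hp.1.1, lt_of_lt_of_le hz₁ hp.2.1⟩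
  have hcont := (continuousOn_parityAmplitude₂ c).mono hsub
  have hScpt : IsCompact S := isCompact_Icc.prod isCompact_Icc
  obtain ⟨pm, hpm, hmin⟩ := hScpt.exists_isMinOn hne hcont
  obtain ⟨pM, hpM, hmax⟩ := hScpt.exists_isMaxOn hne hcont
  rw [isMinOn_iff] at hmin
  rw [isMaxOn_iff] at hmax
  have hpm1 : 0 < pm.1 := lt_of_lt_of_le hy₁ (Set.mem_prod.1 hpm).1.1
  have hpm2 : 0 < pm.2 := lt_of_lt_of_le hz₁ (Set.mem_prod.1 hpm).2.1
  refine ⟨parityAmplitude c pm.1 pm.2, parityAmplitude c pM.1 pM.2, parityAmplitude_pos hpm1 hpm2 hc, fun y hy z hz => ?_⟩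
  have hp : (y, z) ∈ S := Set.mem_prod.2 ⟨hy, hz⟩
  exact ⟨hmin (y, z) hp, hmax (y, z) hp⟩

/-! ## §4 The amplitude correction along a line is `C²` -/

/-- ★ **`G_c(t) = c·Λ_v(t) + log A_c(e^{A+tv₁}, e^{B+tv₂})` is `C²`** (`A_c` is a rational function of `e^{A+tv₁}`, `e^{B+tv₂}` and `e^{Λ_v(t)}` with a
positive denominator, positive itself; `Λ_v` is `C²` by §1).
[cite: DemboZeitouni2010, §2.3 (lane statement); MadrasSlade1993, §1.1 eq. (1.1.4) p. 5; Stanley2012EC1, §4.1 Theorem 4.1.1 (iii)] -/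
theorem contDiff_two_parityG_line (A B v₁ v₂ : ℝ) {c : ℕ} (hc : c < 2) :
    ContDiff ℝ 2 (fun t : ℝ => (c : ℝ) * Real.log (stripMuY₂ 1 (Real.exp (A + t * v₁)) (Real.exp (B + t * v₂)))
      + Real.log (parityAmplitude c (Real.exp (A + t * v₁)) (Real.exp (B + t * v₂)))) := by
  obtain ⟨Λ, hΛdef⟩ : ∃ Λ : ℝ → ℝ, Λ = fun t => Real.log (stripMuY₂ 1 (Real.exp (A + t * v₁)) (Real.exp (B + t * v₂))) := ⟨_, rfl⟩
  have hΛ : ContDiff ℝ 2 Λ := by rw [hΛdef]; exact (contDiff_two_log_stripMuY₂_line A B v₁ v₂).1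
  have hμΛ : ∀ t, stripMuY₂ 1 (Real.exp (A + t * v₁)) (Real.exp (B + t * v₂)) = Real.exp (Λ t) := fun t => by
    rw [hΛdef]; exact (Real.exp_log (stripMuY₂_pos 1 (Real.exp_pos _) (Real.exp_pos _))).symm
  have hlogΛ : ∀ t, Real.log (Real.exp (Λ t)) = Λ t := fun t => Real.log_exp _
  have hpos : ∀ t, 0 < parityAmplitude c (Real.exp (A + t * v₁)) (Real.exp (B + t * v₂)) :=
    fun t => parityAmplitude_pos (Real.exp_pos _) (Real.exp_pos _) hc
  have hden0 : ∀ t, ((Real.exp (A + t * v₁) - Real.exp (B + t * v₂)) ^ 2 + 2 * Real.exp (A + t * v₁) + 2 * Real.exp (B + t * v₂) + 1) ^ 2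
      * ((Real.exp (A + t * v₁) + Real.exp (B + t * v₂)) * (Real.exp (Λ t) ^ 2) ^ 2
          - 2 * (Real.exp (A + t * v₁) * Real.exp (B + t * v₂)) * Real.exp (Λ t) ^ 2
          + 3 * (Real.exp (A + t * v₁) * Real.exp (B + t * v₂))) ≠ 0 := by
    intro t
    have h := amplitudeDen_pos (Real.exp_pos (A + t * v₁)) (Real.exp_pos (B + t * v₂))
    rw [hμΛ] at h
    exact mul_ne_zero (by positivity) h.ne'
  have hden1 : ∀ t, ((Real.exp (A + t * v₁) - Real.exp (B + t * v₂)) ^ 2 + 2 * Real.exp (A + t * v₁) + 2 * Real.exp (B + t * v₂) + 1) ^ 2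
      * Real.exp (Λ t)
      * ((Real.exp (A + t * v₁) + Real.exp (B + t * v₂)) * (Real.exp (Λ t) ^ 2) ^ 2
          - 2 * (Real.exp (A + t * v₁) * Real.exp (B + t * v₂)) * Real.exp (Λ t) ^ 2
          + 3 * (Real.exp (A + t * v₁) * Real.exp (B + t * v₂))) ≠ 0 := by
    intro t
    have h := amplitudeDen_pos (Real.exp_pos (A + t * v₁)) (Real.exp_pos (B + t * v₂))
    rw [hμΛ] at h
    exact mul_ne_zero (mul_ne_zero (by positivity) (Real.exp_pos _).ne') h.ne'
  have hEA : ContDiff ℝ 2 (fun t : ℝ => Real.exp (A + t * v₁)) := by fun_prop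
  have hEB : ContDiff ℝ 2 (fun t : ℝ => Real.exp (B + t * v₂)) := by fun_prop
  have hEΛ : ContDiff ℝ 2 (fun t : ℝ => Real.exp (Λ t)) := hΛ.exp
  interval_cases c
  · have hne : ∀ t, parityAmplitude 0 (Real.exp (A + t * v₁)) (Real.exp (B + t * v₂)) ≠ 0 := fun t => (hpos t).ne'
    simp only [parityAmplitude, if_true, hμΛ, pfU₀, pfU₂, pfU₄] at hne ⊢
    simp only [Nat.cast_zero, zero_mul, zero_add]
    refine ContDiff.log ?_ hne
    fun_prop (disch := assumption)
  · have hne : ∀ t, parityAmplitude 1 (Real.exp (A + t * v₁)) (Real.exp (B + t * v₂)) ≠ 0 := fun t => (hpos t).ne'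
    simp only [parityAmplitude, one_ne_zero, if_false, hμΛ, pfU₁, pfU₃, pfU₅, hlogΛ] at hne ⊢
    simp only [Nat.cast_one, one_mul]
    refine ContDiff.add hΛ (ContDiff.log ?_ hne)
    fun_prop (disch := assumption)

/-! ## §5 ★★★ The variance of every linear statistic along each parity, via the quasi-linear engine -/

/-- Derivative data from `C²` (plumbing copy of the tree's private lemma). [cite: DemboZeitouni2010, §2.3 (lane plumbing)] -/
private theorem derivData_of_contDiff_two_lin {g : ℝ → ℝ} (hg : ContDiff ℝ 2 g) (τ : ℝ) :
    (∀ t, HasDerivAt g (deriv g t) t) ∧ (∀ t, HasDerivAt (deriv g) (deriv (deriv g) t) t) ∧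
      Continuous (deriv (deriv g)) ∧ ∃ B, ∀ t ∈ Set.Icc (-τ) τ, |deriv (deriv g) t| ≤ B := by
  have h1 : Differentiable ℝ g := hg.differentiable (by norm_num)
  have h2 : ContDiff ℝ 1 (deriv g) :=
    (contDiff_succ_iff_deriv.1 (show ContDiff ℝ ((1 : WithTop ℕ∞) + 1) g from hg)).2.2
  have h3 : Differentiable ℝ (deriv g) := h2.differentiable (by norm_num)
  have h4 : Continuous (deriv (deriv g)) :=
    ((contDiff_succ_iff_deriv.1 (show ContDiff ℝ ((0 : WithTop ℕ∞) + 1) (deriv g) from h2)).2.2).continuous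
  refine ⟨fun t => (h1 t).hasDerivAt, fun t => (h3 t).hasDerivAt, h4, ?_⟩
  obtain ⟨B, hB⟩ := isCompact_Icc.exists_bound_of_continuousOn (h4.continuousOn (s := Set.Icc (-τ) τ))
  exact ⟨B, fun t ht => by simpa [Real.norm_eq_abs] using hB t ht⟩

/-- ★★★ **THE VARIANCE OF A LINEAR CONTACT STATISTIC ALONG EACH PARITY**: for `y, z > 0`, every direction `(v₁,v₂)` and `c ∈ {0,1}`,
`Var_{2M+c,y,z}(v₁bc + v₂tc) / M → 2·H_{y,z}(v)`.  Proof: `tendsto_deriv2_div_of_quasiLinear` with `F_M(t) = log C_{1,2M+c}(y e^{tv₁}, z e^{tv₂})`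
(`F_M'' =` tilted variance of the statistic, §2), `φ = 2Λ_v` (§1), `G = cΛ_v + log A_c` (`C²`, §4), and the uniform remainder on the rectangle
`[ye^{−|v₁|}, ye^{|v₁|}] × [ze^{−|v₂|}, ze^{|v₂|}]` (`exists_uniform_log_two_term_rect`).
[cite: DemboZeitouni2010, §2.3 (Gärtner–Ellis; lane statement: covariance density = Hessian of the limiting free energy); BeatonBousquetMelouDeGierDuminilCopinGuttmann2014, §3.2 Proposition 6 (arXiv v5 p. 10); MadrasSlade1993, §1.1 eq. (1.1.4) p. 5] -/
theorem tendsto_varLin_parity_div (hy : 0 < y) (hz : 0 < z) (v₁ v₂ : ℝ) {c : ℕ} (hc : c < 2) :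
    Tendsto (fun M : ℕ => varLin v₁ v₂ y z (2 * M + c) / M) atTop (𝓝 (2 * contactHess v₁ v₂ y z)) := by
  -- log-fugacities
  set A₀ := Real.log y with hA₀
  set B₀ := Real.log z with hB₀
  have hyA : Real.exp A₀ = y := Real.exp_log hy
  have hzB : Real.exp B₀ = z := Real.exp_log hz
  have ept : ∀ t, y * Real.exp (t * v₁) = Real.exp (A₀ + t * v₁) ∧ z * Real.exp (t * v₂) = Real.exp (B₀ + t * v₂) := fun t => by
    constructor <;> rw [Real.exp_add] <;> simp [hyA, hzB]
  -- the free energy along the line and its derivatives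
  obtain ⟨hΛ2, hΛd, hΛdd, hΛ2c⟩ := contDiff_two_log_stripMuY₂_line A₀ B₀ v₁ v₂
  set φ : ℝ → ℝ := fun t => 2 * Real.log (stripMuY₂ 1 (Real.exp (A₀ + t * v₁)) (Real.exp (B₀ + t * v₂))) with hφ
  set φ1 : ℝ → ℝ := fun t => 2 * (v₁ * contactB (Real.exp (A₀ + t * v₁)) (Real.exp (B₀ + t * v₂))
      + v₂ * contactB (Real.exp (B₀ + t * v₂)) (Real.exp (A₀ + t * v₁))) with hφ1
  set φ2 : ℝ → ℝ := fun t => 2 * contactHess v₁ v₂ (Real.exp (A₀ + t * v₁)) (Real.exp (B₀ + t * v₂)) with hφ2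
  have hφd : ∀ t, HasDerivAt φ (φ1 t) t := fun t => by
    have h := (hΛd t).const_mul 2
    simpa [hφ, hφ1] using h
  have hφ1d : ∀ t, HasDerivAt φ1 (φ2 t) t := fun t => by
    have h := (hΛdd t).const_mul 2
    simpa [hφ1, hφ2] using h
  have hφ2c : ContinuousAt φ2 0 := (continuous_const.mul hΛ2c).continuousAt
  -- `G = cΛ_v + log A_c` along the line, C²
  set G : ℝ → ℝ := fun t => (c : ℝ) * Real.log (stripMuY₂ 1 (Real.exp (A₀ + t * v₁)) (Real.exp (B₀ + t * v₂)))
      + Real.log (parityAmplitude c (Real.exp (A₀ + t * v₁)) (Real.exp (B₀ + t * v₂))) with hG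
  have hG2 : ContDiff ℝ 2 G := contDiff_two_parityG_line A₀ B₀ v₁ v₂ hc
  obtain ⟨hGd, hG1d, hG2c, ⟨BG, hBG⟩⟩ := derivData_of_contDiff_two_lin hG2 1
  obtain ⟨BG0, hBG0⟩ := isCompact_Icc.exists_bound_of_continuousOn ((hG2.continuous).continuousOn (s := Set.Icc (-1 : ℝ) 1))
  -- the rectangle containing the curve `|t| ≤ 1`
  set y₁ := Real.exp (A₀ - |v₁|) with hy₁def
  set y₂ := Real.exp (A₀ + |v₁|) with hy₂def
  set z₁ := Real.exp (B₀ - |v₂|) with hz₁def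
  set z₂ := Real.exp (B₀ + |v₂|) with hz₂def
  have hy₁ : 0 < y₁ := Real.exp_pos _
  have hz₁ : 0 < z₁ := Real.exp_pos _
  have h12 : y₁ ≤ y₂ := Real.exp_le_exp.2 (by linarith [abs_nonneg v₁])
  have hz12 : z₁ ≤ z₂ := Real.exp_le_exp.2 (by linarith [abs_nonneg v₂])
  obtain ⟨a₁, a₂, ha₁, hA⟩ := parityAmplitude_bounds_rect hy₁ h12 hz₁ hz12 hc
  obtain ⟨ε, hεlim, hεb⟩ := exists_uniform_log_two_term_rect hy₁ h12 hz₁ hz12 hc ha₁ hA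
    (fun y' hy' z' hz' => tendsto_parityAmplitude (lt_of_lt_of_le hy₁ hy'.1) (lt_of_lt_of_le hz₁ hz'.1) hc)
  have hmemI : ∀ t ∈ Set.Ioo (-1 : ℝ) 1, Real.exp (A₀ + t * v₁) ∈ Set.Icc y₁ y₂ ∧ Real.exp (B₀ + t * v₂) ∈ Set.Icc z₁ z₂ := by
    intro t ht
    have ht1 : |t| ≤ 1 := abs_le.2 ⟨ht.1.le, ht.2.le⟩
    have b1 : |t * v₁| ≤ |v₁| := by
      rw [abs_mul]; exact (mul_le_mul_of_nonneg_right ht1 (abs_nonneg _)).trans (by rw [one_mul])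
    have b2 : |t * v₂| ≤ |v₂| := by
      rw [abs_mul]; exact (mul_le_mul_of_nonneg_right ht1 (abs_nonneg _)).trans (by rw [one_mul])
    obtain ⟨b1l, b1u⟩ := abs_le.1 b1
    obtain ⟨b2l, b2u⟩ := abs_le.1 b2
    exact ⟨⟨Real.exp_le_exp.2 (by linarith), Real.exp_le_exp.2 (by linarith)⟩,
      ⟨Real.exp_le_exp.2 (by linarith), Real.exp_le_exp.2 (by linarith)⟩⟩
  -- the family `F_M(t) = log C_{1,2M+c}(y e^{tv₁}, z e^{tv₂})` (`F_0 := 0`) and its cumulant data (§2)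
  set L : ℕ → Site 2 × (ℕ → Site 2) → ℝ := fun N q =>
    v₁ * (bottomVisits₀ q.1 q.2 N : ℝ) + v₂ * (topVisits₀ 1 q.1 q.2 N : ℝ) with hL
  set Zf : ℕ → ℝ → ℝ := fun N t => ∑ q ∈ stripPairs 1 N, wgt y z N q * Real.exp (t * L N q) with hZf
  set M1f : ℕ → ℝ → ℝ := fun N t => ∑ q ∈ stripPairs 1 N, wgt y z N q * L N q * Real.exp (t * L N q) with hM1f
  set M2f : ℕ → ℝ → ℝ := fun N t => ∑ q ∈ stripPairs 1 N, wgt y z N q * L N q ^ 2 * Real.exp (t * L N q) with hM2f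
  set vf : ℕ → ℝ → ℝ := fun N t => M2f N t / Zf N t - (M1f N t / Zf N t) ^ 2 with hvf
  set W : ℝ := |v₁| + |v₂| with hW
  have hW0 : 0 ≤ W := by positivity
  have facts : ∀ N, (∀ t, HasDerivAt (fun t => Real.log (stripZ₂ 1 N (y * Real.exp (t * v₁)) (z * Real.exp (t * v₂)))) (M1f N t / Zf N t) t) ∧
      (∀ t, HasDerivAt (fun t => M1f N t / Zf N t) (vf N t) t) ∧ (∀ t, 0 ≤ vf N t) ∧ vf N 0 = varLin v₁ v₂ y z N ∧
      M1f N 0 / Zf N 0 = meanLin v₁ v₂ y z N ∧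
      (∀ t, 0 ≤ t → vf N t ≤ Real.exp (2 * (W * ((N : ℝ) + 1)) * t) * vf N 0 ∧
        vf N 0 ≤ Real.exp (2 * (W * ((N : ℝ) + 1)) * t) * vf N t) :=
    fun N => linContactFreeEnergy_facts hy hz v₁ v₂ N
  set F : ℕ → ℝ → ℝ := fun M => if M = 0 then fun _ => 0 else
    fun t => Real.log (stripZ₂ 1 (2 * M + c) (y * Real.exp (t * v₁)) (z * Real.exp (t * v₂))) with hF
  set F1 : ℕ → ℝ → ℝ := fun M => if M = 0 then fun _ => 0 else fun t => M1f (2 * M + c) t / Zf (2 * M + c) t with hF1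
  set F2 : ℕ → ℝ → ℝ := fun M => if M = 0 then fun _ => 0 else fun t => vf (2 * M + c) t with hF2
  set ε' : ℕ → ℝ := fun M => if M = 0 then BG0 else ε M with hε'
  -- the engine
  have key := tendsto_deriv2_div_of_quasiLinear (F := F) (F1 := F1) (F2 := F2) (φ := φ) (φ1 := φ1) (φ2 := φ2)
    (G := G) (G1 := deriv G) (G2 := deriv (deriv G)) (τ := 1) (K := 10 * W) (B := BG) (ε := ε') one_pos (by positivity)
    ?_ ?_ ?_ ?_ (fun t _ => hφd t) (fun t _ => hφ1d t) hφ2c (fun t _ => hGd t) (fun t _ => hG1d t)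
    (fun t ht => hBG t ⟨ht.1.le, ht.2.le⟩) ?_ ?_
  · -- conclusion
    have e1 : (fun M : ℕ => varLin v₁ v₂ y z (2 * M + c) / M) = fun M : ℕ => F2 M 0 / M := by
      funext M
      rcases Nat.eq_zero_or_pos M with h | h
      · subst h; simp
      · have hM : M ≠ 0 := by omega
        simp only [hF2, hM, if_false, (facts (2 * M + c)).2.2.2.1]
    have e2 : 2 * contactHess v₁ v₂ y z = φ2 0 := by
      simp only [hφ2, zero_mul, add_zero, hyA, hzB]
    rw [e1, e2]
    exact key
  · -- hF
    intro M t _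
    rcases Nat.eq_zero_or_pos M with h | h
    · subst h; simp only [hF, hF1, if_true]; exact hasDerivAt_const t 0
    · have hM : M ≠ 0 := by omega
      simp only [hF, hF1, hM, if_false]
      exact (facts (2 * M + c)).1 t
  · -- hF1
    intro M t _
    rcases Nat.eq_zero_or_pos M with h | h
    · subst h; simp only [hF1, hF2, if_true]; exact hasDerivAt_const t 0
    · have hM : M ≠ 0 := by omega
      simp only [hF1, hF2, hM, if_false]
      exact (facts (2 * M + c)).2.1 t
  · -- hF2 ≥ 0
    intro M
    rcases Nat.eq_zero_or_pos M with h | h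
    · subst h; simp [hF2]
    · have hM : M ≠ 0 := by omega
      simp only [hF2, hM, if_false]
      exact (facts (2 * M + c)).2.2.1 0
  · -- hosc
    intro M t ht
    rcases Nat.eq_zero_or_pos M with h | h
    · subst h; simp [hF2]
    · have hM : M ≠ 0 := by omega
      simp only [hF2, hM, if_false]
      obtain ⟨o1, o2⟩ := (facts (2 * M + c)).2.2.2.2.2 t ht.1
      have hv0 := (facts (2 * M + c)).2.2.1 0
      have hvt := (facts (2 * M + c)).2.2.1 t
      have hexp : Real.exp (2 * (W * ((((2 * M + c : ℕ) : ℝ)) + 1)) * t) ≤ Real.exp (10 * W * (M : ℝ) * t) := by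
        apply Real.exp_le_exp.2
        have hc1 : (c : ℝ) ≤ 1 := by exact_mod_cast (show c ≤ 1 by omega)
        have hM1 : (1 : ℝ) ≤ M := by exact_mod_cast h
        have ht0 : 0 ≤ t := ht.1
        push_cast
        have h5 : 2 * ((2 * (M : ℝ) + c) + 1) ≤ 10 * M := by nlinarith
        have := mul_le_mul_of_nonneg_left h5 (mul_nonneg hW0 ht0)
        nlinarith
      exact ⟨o1.trans (mul_le_mul_of_nonneg_right hexp hv0), o2.trans (mul_le_mul_of_nonneg_right hexp hvt)⟩
  · -- hr: the uniform remainder along the curve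
    intro M t ht
    rcases Nat.eq_zero_or_pos M with h | h
    · subst h
      simp only [hF, hε', if_true, Nat.cast_zero, zero_mul, sub_zero, zero_sub, abs_neg]
      have := hBG0 t ⟨ht.1.le, ht.2.le⟩
      simpa [Real.norm_eq_abs] using this
    · have hM : M ≠ 0 := by omega
      simp only [hF, hε', hM, if_false]
      obtain ⟨hmy, hmz⟩ := hmemI t ht
      have hb := hεb M (Real.exp (A₀ + t * v₁)) hmy (Real.exp (B₀ + t * v₂)) hmz
      rw [(ept t).1, (ept t).2, hφ, hG]
      have e : Real.log (stripZ₂ 1 (2 * M + c) (Real.exp (A₀ + t * v₁)) (Real.exp (B₀ + t * v₂)))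
            - (M : ℝ) * (2 * Real.log (stripMuY₂ 1 (Real.exp (A₀ + t * v₁)) (Real.exp (B₀ + t * v₂))))
            - ((c : ℝ) * Real.log (stripMuY₂ 1 (Real.exp (A₀ + t * v₁)) (Real.exp (B₀ + t * v₂)))
              + Real.log (parityAmplitude c (Real.exp (A₀ + t * v₁)) (Real.exp (B₀ + t * v₂))))
          = Real.log (stripZ₂ 1 (2 * M + c) (Real.exp (A₀ + t * v₁)) (Real.exp (B₀ + t * v₂)))
            - (2 * (M : ℝ) + c) * Real.log (stripMuY₂ 1 (Real.exp (A₀ + t * v₁)) (Real.exp (B₀ + t * v₂)))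
            - Real.log (parityAmplitude c (Real.exp (A₀ + t * v₁)) (Real.exp (B₀ + t * v₂))) := by ring
      rw [e]
      exact hb
  · -- `M ε'_M → 0`
    refine hεlim.congr' ?_
    filter_upwards [eventually_ge_atTop 1] with M hM
    have hM0 : M ≠ 0 := by omega
    simp only [hε', hM0, if_false]

/-! ## §6 ★★★★ The variance of every linear statistic, the covariance, the total contact number -/

/-- If the even and odd subsequences of `u` converge to `L`, so does `u` (plumbing). [cite: DemboZeitouni2010, §2.3 (lane plumbing)] -/
private theorem tendsto_of_tendsto_even_odd_lin {u : ℕ → ℝ} {l : ℝ} (h0 : Tendsto (fun M => u (2 * M)) atTop (𝓝 l))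
    (h1 : Tendsto (fun M => u (2 * M + 1)) atTop (𝓝 l)) : Tendsto u atTop (𝓝 l) := by
  intro s hs
  have e0 := h0 hs
  have e1 := h1 hs
  rw [Filter.mem_map, mem_atTop_sets] at e0 e1
  rw [Filter.mem_map, mem_atTop_sets]
  obtain ⟨M0, hM0⟩ := e0
  obtain ⟨M1, hM1⟩ := e1
  refine ⟨2 * max M0 M1, fun n hn => ?_⟩
  obtain ⟨m, rfl | rfl⟩ := Nat.even_or_odd' n
  · exact hM0 m (by omega)
  · exact hM1 m (by omega)

/-- `M/(2M+1) → 1/2` (plumbing). [cite: DemboZeitouni2010, §2.3 (lane plumbing)] -/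
private theorem tendsto_natCast_div_two_mul_add_one_lin : Tendsto (fun M : ℕ => (M : ℝ) / (2 * M + 1)) atTop (𝓝 (1 / 2)) := by
  have h1 : Tendsto (fun M : ℕ => (1 : ℝ) / (M : ℝ)) atTop (𝓝 0) := tendsto_one_div_atTop_nhds_zero_nat
  have h2 : Tendsto (fun M : ℕ => (1 : ℝ) / (2 + 1 / (M : ℝ))) atTop (𝓝 (1 / (2 + 0))) :=
    tendsto_const_nhds.div (tendsto_const_nhds.add h1) (by norm_num)
  rw [add_zero] at h2
  refine h2.congr' ?_
  filter_upwards [eventually_ge_atTop 1] with M hM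
  have hM0 : (M : ℝ) ≠ 0 := by exact_mod_cast (show M ≠ 0 by omega)
  field_simp

/-- ★★★★ **THE VARIANCE OF EVERY LINEAR CONTACT STATISTIC**: for all `y, z > 0` and every direction `(v₁, v₂)`,
`Var_{N,y,z}(v₁·bc + v₂·tc) / N → H_{y,z}(v) = (m₂₂v₁² − 2m₁₂v₁v₂ + m₁₁v₂²)/(m₁₁m₂₂ − m₁₂²)` — the COVARIANCE MATRIX of the two contact
numbers grows linearly with rate the inverse `M⁻¹` of the entropy Hessian (= the Hessian of the free energy `log μ₁(e^A, e^B)`).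
[cite: DemboZeitouni2010, §2.3 (lane statement); BeatonBousquetMelouDeGierDuminilCopinGuttmann2014, §3.2 Proposition 6 (arXiv v5 p. 10); JansevanRensburg2000, §3.3 (1st ed.); MadrasSlade1993, §1.1 eq. (1.1.4) p. 5] -/
theorem tendsto_varLin_div (hy : 0 < y) (hz : 0 < z) (v₁ v₂ : ℝ) :
    Tendsto (fun N : ℕ => varLin v₁ v₂ y z N / N) atTop (𝓝 (contactHess v₁ v₂ y z)) := by
  set β := contactHess v₁ v₂ y z with hβ
  have h0 := tendsto_varLin_parity_div hy hz v₁ v₂ (c := 0) (by norm_num)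
  have h1 := tendsto_varLin_parity_div hy hz v₁ v₂ (c := 1) (by norm_num)
  rw [← hβ] at h0 h1
  apply tendsto_of_tendsto_even_odd_lin
  · have h := h0.mul_const (1 / 2 : ℝ)
    rw [show 2 * β * (1 / 2) = β by ring] at h
    refine h.congr' ?_
    filter_upwards [eventually_ge_atTop 1] with M hM
    have hM0 : (M : ℝ) ≠ 0 := by exact_mod_cast (show M ≠ 0 by omega)
    simp only [add_zero]
    push_cast
    field_simp
  · have h := h1.mul tendsto_natCast_div_two_mul_add_one_lin
    rw [show 2 * β * (1 / 2) = β by ring] at h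
    refine h.congr' ?_
    filter_upwards [eventually_ge_atTop 1] with M hM
    have hM0 : (M : ℝ) ≠ 0 := by exact_mod_cast (show M ≠ 0 by omega)
    push_cast
    field_simp

/-- ★★★★ **THE COVARIANCE OF THE TWO CONTACT NUMBERS**: for all `y, z > 0`,
`Cov_{N,y,z}(bc, tc) / N → ∂b/∂B |_{(log y, log z)} = d/dB b(y, e^B)|_{B = log z}` — the mixed susceptibility (Maxwell: `= ∂b'/∂A`), by
polarization of `tendsto_varLin_div` in the three directions `(1,0), (0,1), (1,1)`.
[cite: DemboZeitouni2010, §2.3 (lane statement); JansevanRensburg2000, §3.3 (1st ed.: fluctuations in adsorption models); BeatonBousquetMelouDeGierDuminilCopinGuttmann2014, §3.2 Proposition 6 (arXiv v5 p. 10)] -/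
theorem tendsto_covContacts_div (hy : 0 < y) (hz : 0 < z) :
    Tendsto (fun N : ℕ => covContacts y z N / N) atTop (𝓝 (deriv (fun B => contactB y (Real.exp B)) (Real.log z))) := by
  obtain ⟨-, -, e3⟩ := contactHess_axes hy hz
  have h := ((tendsto_varLin_div hy hz 1 1).sub (tendsto_varLin_div hy hz 1 0)).sub (tendsto_varLin_div hy hz 0 1)
  have h' := h.mul_const (1 / 2 : ℝ)
  rw [show (contactHess 1 1 y z - contactHess 1 0 y z - contactHess 0 1 y z) * (1 / 2)
      = (contactHess 1 1 y z - contactHess 1 0 y z - contactHess 0 1 y z) / 2 by ring, e3] at h'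
  refine h'.congr fun N => ?_
  simp only [varLin_eq]
  ring

/-- ★★★ **THE WALLS COMPETE AT THE LEVEL OF FLUCTUATIONS**: the covariance rate is `−m₁₂/(m₁₁m₂₂ − m₁₂²) < 0` — the numbers of bottom and of top
contacts are, for large `N`, NEGATIVELY correlated with a covariance growing linearly in `N`.
[cite: DemboZeitouni2010, §2.3 (lane statement); JansevanRensburg2000, §3.3 (1st ed.)] -/
theorem tendsto_covContacts_div_explicit (hy : 0 < y) (hz : 0 < z) :
    let b := contactB y z
    let b' := contactB z y
    let m₁₁ := 4 / (1 - 2 * b - 2 * b') + 8 / (4 * b + 2 * b' - 1) + 2 / (2 * b + 4 * b' - 1) - 1 / b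
    let m₁₂ := 4 / (1 - 2 * b - 2 * b') + 4 / (4 * b + 2 * b' - 1) + 4 / (2 * b + 4 * b' - 1)
    let m₂₂ := 4 / (1 - 2 * b - 2 * b') + 2 / (4 * b + 2 * b' - 1) + 8 / (2 * b + 4 * b' - 1) - 1 / b'
    Tendsto (fun N : ℕ => covContacts y z N / N) atTop (𝓝 (-m₁₂ / (m₁₁ * m₂₂ - m₁₂ ^ 2))) ∧
      -m₁₂ / (m₁₁ * m₂₂ - m₁₂ ^ 2) < 0 := by
  intro b b' m₁₁ m₁₂ m₂₂
  obtain ⟨hD, hm12, -, dB, -, -, hneg⟩ := hasDerivAt_contactB_log (Real.log y) (Real.log z)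
  simp only [Real.exp_log hy, Real.exp_log hz] at hD hm12 dB hneg
  have h := tendsto_covContacts_div hy hz
  rw [dB.deriv] at h
  exact ⟨h, hneg⟩

/-- ★★★ **THE VARIANCE OF THE TOTAL NUMBER OF SURFACE CONTACTS**: `Var_{N,y,z}(bc + tc)/N → H_{y,z}(1,1) = (m₁₁ − 2m₁₂ + m₂₂)/D > 0`.
[cite: DemboZeitouni2010, §2.3 (lane statement); JansevanRensburg2000, §3.3 (1st ed.)] -/
theorem tendsto_varTotalContacts_div (hy : 0 < y) (hz : 0 < z) :
    Tendsto (fun N : ℕ => varLin 1 1 y z N / N) atTop (𝓝 (contactHess 1 1 y z)) ∧ 0 < contactHess 1 1 y z :=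
  ⟨tendsto_varLin_div hy hz 1 1, contactHess_pos hy hz (by simp)⟩

/-- ★★ Consistency with the one-wall theorems: `H(1,0) = ∂b/∂A` and `H(0,1) = ∂b(e^B,y)/∂B`, so `tendsto_varLin_div` at `(1,0)` / `(0,1)` is the
tree's `tendsto_varContacts_div` / `tendsto_varTopContacts_div`. [cite: DemboZeitouni2010, §2.3 (lane statement)] -/
theorem tendsto_varLin_div_axes (hy : 0 < y) (hz : 0 < z) :
    Tendsto (fun N : ℕ => varContacts y z N / N) atTop (𝓝 (contactHess 1 0 y z)) ∧
      Tendsto (fun N : ℕ => varTopContacts y z N / N) atTop (𝓝 (contactHess 0 1 y z)) := by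
  refine ⟨(tendsto_varLin_div hy hz 1 0).congr fun N => ?_, (tendsto_varLin_div hy hz 0 1).congr fun N => ?_⟩
  · rw [(varLin_axes y z N).1]
  · rw [(varLin_axes y z N).2]
end WidthOneYZ

end Literature.Probability.RandomPlanarGeometry.SAW.HexBW

end
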